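import Mathlib
import Summits.NavierStokesRegularity.NavierStokesRegularity.Theorems.SubOnsagerCeilingKPRelabelCorners
import Summits.NavierStokesRegularity.NavierStokesRegularity.Theorems.SubOnsagerCeilingGapArchitectures5
import HarnessLib

/-!
# The architecture corners at every placement of their components, at EVERY scale ratio `1 + ε₀ ∈ [5/4, 2]`
# (helper file for the crux `SubOnsagerCeiling.ForwardTailCeilingKP`, stmt-NavierStokesRegularity-27057, `--supports`;
# hand leafhand-ns-subonsagerceiling-4 gen 22 — the `[1/4, 1]` re-issue of `SubOnsagerCeilingKPRelabelCorners`)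

With the chain descent of hands 4-g20 / 4-g21 glued and transported (`SubOnsagerCeilingGapArchitectures5`:
`kpFanGap21Wide_ceilingAt`, `kpTwoCycleGap21Wide_ceilingAt`, `kpPermGap21Wide_ceilingAt` at every `ε₀ ∈ [1/4, 1]`), the relabeling
covariance `kpRelabel_ceilingAt` / `kpRelabel_shellBarrierAt` (`Theorems/SubOnsagerCeilingKPRelabel.lean`) puts the uniform FAN and the
uniform RE-ENTRY PAIR on ANY components at every `ε₀ ∈ [1/4, 1]` — the whole ratio range of the registered stub
`stub_primaryGradedLargeRatio` of the LEAD skeleton `Cruxes/ForwardTailCeilingKP/Lines/kp_shell_barrier.lean`: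

* `kpRelabel_fan_ceilingAt_quarter` — `CeilingAt R ε₀ β` for `β = kpFanTable w ∘ σ`, every `w`, every `σ`, every `ε₀ ∈ [1/4, 1]`
  (supersedes `kpRelabel_fan_ceilingAt`, `[9/25, 1]`);
* `kpRelabel_twoCycle_ceilingAt_quarter` — `CeilingAt R ε₀ β` for `β = kpTwoCycleTable c c ∘ σ`, `c > 0`, every `ε₀ ∈ [1/4, 1]`
  (supersedes `kpRelabel_twoCycle_ceilingAt`);
* `kpRelabel_fan_shellBarrierAt_quarter`, `kpRelabel_twoCycle_shellBarrierAt_quarter`, `kpRelabel_perm_shellBarrierAt_quarter` — the same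
  corners in the SHELL-BARRIER currency (`kpRelabel_shellBarrierAt`), the currency of the registered stubs' level-0 clause.

HONEST FRAMING: bookkeeping about Tao-type MODEL lattice ODEs (route SubOnsagerCeiling, rung TL-M2Break); widens proved corners by
placement and ratio range only; no stub, crux or summit is proved and nothing here bears on Navier–Stokes regularity.
[cite: Tao2016AveragedNS, §4 (4.2)–(4.3), (4.13)] [cite: BarbatoMorandinRomito2011, §3.2]
-/

noncomputable section

-- the sub-problem namespace `NavierStokesRegularity.NavierStokesRegularity` is the tree's layout (D-0017)
set_option linter.dupNamespace false

namespace Summit.NavierStokesRegularity.NavierStokesRegularity.Theorems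

open Literature.Analysis.FluidPDE.TaoCascade
open Summit.NavierStokesRegularity.NavierStokesRegularity.Theorems.SubOnsagerCeiling

variable {β : Fin 4 → Fin 4 → Fin 4 → ℤ × ℤ × ℤ → ℝ} (σ : Equiv.Perm (Fin 4))

/-- **The uniform KP fan at any placement, `ε₀ ∈ [1/4, 1]`**: `CeilingAt R ε₀ β` for `β = kpFanTable w ∘ σ`.
[cite: Tao2016AveragedNS, §4 (4.13)] -/
theorem kpRelabel_fan_ceilingAt_quarter (w : Fin 4 → ℝ)
    (hβ : ∀ i₁ i₂ i₃ μ, β i₁ i₂ i₃ μ = kpFanTable w (σ i₁) (σ i₂) (σ i₃) μ) :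
    ∀ R : ℝ, ∀ ε₀ : ℝ, (1 : ℝ) / 4 ≤ ε₀ → ε₀ ≤ 1 → CeilingAt R ε₀ β :=
  fun R ε₀ h1 h2 => kpRelabel_ceilingAt σ hβ (kpFanGap21Wide_ceilingAt w R ε₀ h1 h2)

/-- **The uniform re-entry pair at any placement, `ε₀ ∈ [1/4, 1]`**: `CeilingAt R ε₀ β` for `β = kpTwoCycleTable c c ∘ σ`, `c > 0`.
[cite: Tao2016AveragedNS, §4 (4.13)] -/
theorem kpRelabel_twoCycle_ceilingAt_quarter {c : ℝ} (hc : 0 < c)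
    (hβ : ∀ i₁ i₂ i₃ μ, β i₁ i₂ i₃ μ = kpTwoCycleTable c c (σ i₁) (σ i₂) (σ i₃) μ) :
    ∀ R : ℝ, ∀ ε₀ : ℝ, (1 : ℝ) / 4 ≤ ε₀ → ε₀ ≤ 1 → CeilingAt R ε₀ β :=
  fun R ε₀ h1 h2 => kpRelabel_ceilingAt σ hβ (kpTwoCycleGap21Wide_ceilingAt hc R ε₀ h1 h2)

/-- **The uniform KP fan at any placement, shell-barrier currency, `ε₀ ∈ [1/4, 1]`**: `ShellBarrierAt R ε₀ β` for
`β = kpFanTable w ∘ σ`. [cite: BarbatoMorandinRomito2011, §3.2] -/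
theorem kpRelabel_fan_shellBarrierAt_quarter (w : Fin 4 → ℝ)
    (hβ : ∀ i₁ i₂ i₃ μ, β i₁ i₂ i₃ μ = kpFanTable w (σ i₁) (σ i₂) (σ i₃) μ) :
    ∀ R : ℝ, ∀ ε₀ : ℝ, (1 : ℝ) / 4 ≤ ε₀ → ε₀ ≤ 1 → ShellBarrierAt R ε₀ β :=
  fun R ε₀ h1 h2 => kpRelabel_shellBarrierAt σ hβ (kpFanGap21Wide_shellBarrierAt w R ε₀ h1 h2)

/-- **The uniform re-entry pair at any placement, shell-barrier currency, `ε₀ ∈ [1/4, 1]`**: `ShellBarrierAt R ε₀ β` for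
`β = kpTwoCycleTable c c ∘ σ`, `c > 0`. [cite: BarbatoMorandinRomito2011, §3.2] -/
theorem kpRelabel_twoCycle_shellBarrierAt_quarter {c : ℝ} (hc : 0 < c)
    (hβ : ∀ i₁ i₂ i₃ μ, β i₁ i₂ i₃ μ = kpTwoCycleTable c c (σ i₁) (σ i₂) (σ i₃) μ) :
    ∀ R : ℝ, ∀ ε₀ : ℝ, (1 : ℝ) / 4 ≤ ε₀ → ε₀ ≤ 1 → ShellBarrierAt R ε₀ β :=
  fun R ε₀ h1 h2 => kpRelabel_shellBarrierAt σ hβ (kpTwoCycleGap21Wide_shellBarrierAt hc R ε₀ h1 h2)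

/-- **Uniform KP permutation networks at any placement, shell-barrier currency, `ε₀ ∈ [1/4, 1]`**: `ShellBarrierAt R ε₀ β` for
`β = kpPermTable τ c ∘ σ` with `c` constant on `τ`-orbits (the class is placement-closed, but the placed form is what a table
census reads off). [cite: BarbatoMorandinRomito2011, §3.2] -/
theorem kpRelabel_perm_shellBarrierAt_quarter {τ : Equiv.Perm (Fin 4)} {c : Fin 4 → ℝ} (hcyc : ∀ a, c (τ a) = c a)
    (hβ : ∀ i₁ i₂ i₃ μ, β i₁ i₂ i₃ μ = kpPermTable τ c (σ i₁) (σ i₂) (σ i₃) μ) :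
    ∀ R : ℝ, ∀ ε₀ : ℝ, (1 : ℝ) / 4 ≤ ε₀ → ε₀ ≤ 1 → ShellBarrierAt R ε₀ β :=
  fun R ε₀ h1 h2 => kpRelabel_shellBarrierAt σ hβ (kpPermGap21Wide_shellBarrierAt hcyc R ε₀ h1 h2)

end Summit.NavierStokesRegularity.NavierStokesRegularity.Theorems

end
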